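import Summits.Parity.BatemanHorn.Theses.IsogenyRedei

/-!
# drefute (gen 2) — line `cofactor-root-discrepancy` of crux `IsogenyRedei.SplitBlockJacobi` (stmt-Parity-11583)

Kernel-checked structural findings on the stub set (vocabulary copied VERBATIM from
`Cruxes/SplitBlockJacobi/Lines/cofactor-root-discrepancy.lean`, which is not importable from here):

* `tierWeylBound_antitone` — `TierWeylBound θ μ → TierWeylBound θ μ'` for `μ ≤ μ'` (smaller tier parameter =
  more boxes = stronger statement).
* `weylShallow_of_weylDeep` — hence STUB 5 (`stub_weylShallow`, tiers `2/3 ≤ μ < 1`) is IMPLIED by STUB 6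
  (`stub_weylDeep`, tiers `0 < μ < 2/3`): the shallow stub is logically redundant in the composition.
* `SplitBlockJacobi_of_five` — the crux from stubs 1, 2, 3, 4, 6 only (no `stub_weylShallow`), same `ε/3` glue as the
  skeleton's `SplitBlockJacobi_of` with the case split replaced by antitonicity at `min μ (1/2)`.
* `row_of_tierWeylBound` — the single-row instance of `TierWeylBound` (sub-interval `(Q₀-1, Q₀]`): for
  `μ + θ < 1` these rows are longer than `x^{1-ε₀}`, so STUB 6 contains a power-saving bound for the Legendre-twisted
  Duke–Friedlander–Iwaniec root-equidistribution sum over PRIMES (see the report for why this is over-strength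
  relative to what Poisson needs only in kind, not in substance).
* `row_of_mixedBilinear` — the same instance of the lead's corner hypothesis `MixedBilinear δ₀` (hypothesis of the
  registered helper `tierWeylBound_of_mixedBilinear`), which has NO aspect-ratio bound: with `P₂ → ∞` at fixed `Q₀` it
  asserts `|Σ_{p ∈ (P₂,P₂']} (Q₀|p) S(h, Q₀p)| ≤ ((Q₀-1)P₂)^{1-δ₀}` for all `0 < |h| ≤ ((Q₀-1)P₂)^{δ₀}`, i.e. a
  POWER SAVING in the twisted DFI prime sum — open since DFI 1995 ("by no means could we do better [than 1/log x]").
  The corner application only ever uses boxes with `P₂ ≤ 2(2P₁)^{1+2δ₀/3}`; see `stub-misstated` note.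
-/

set_option linter.dupNamespace false

noncomputable section

open Finset Filter

namespace Summit.Parity.BatemanHorn.Cruxes.SplitBlockJacobi.DrefuteG2

/-! ### Vocabulary (verbatim copies of the line's definitions) -/

def J (θ : ℝ) (x : ℕ) : ℝ :=
  ∑ t ∈ Finset.Icc 1 x, ∑ q ∈ ((t ^ 2 + 1).primeFactors ×ˢ (t ^ 2 + 1).primeFactors).filter
    (fun q : ℕ × ℕ => (x : ℝ) ^ θ < (q.1 : ℝ) ∧ q.1 < q.2), (jacobiSym (q.1 : ℤ) q.2 : ℝ)

def pairs (θ : ℝ) (x : ℕ) : Finset (ℕ × ℕ) :=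
  (Finset.range (x ^ 2 + 2) ×ˢ Finset.range (x ^ 2 + 2)).filter (fun q : ℕ × ℕ =>
    q.1.Prime ∧ q.2.Prime ∧ q.1 % 4 = 1 ∧ q.2 % 4 = 1 ∧ (x : ℝ) ^ θ < (q.1 : ℝ) ∧ q.1 < q.2 ∧
      q.1 * q.2 ≤ x ^ 2 + 1)

def rootCount (q x : ℕ) : ℕ := ((Finset.Icc 1 x).filter (fun t : ℕ => q ∣ t ^ 2 + 1)).card

def disc (q x : ℕ) : ℝ := (rootCount q x : ℝ) - 4 * (x : ℝ) / (q : ℝ)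

def Epart (θ : ℝ) (x : ℕ) : ℝ :=
  ∑ q ∈ pairs θ x, (jacobiSym (q.1 : ℤ) q.2 : ℝ) * (4 * (x : ℝ) / ((q.1 * q.2 : ℕ) : ℝ))

def Dbulk (θ μ : ℝ) (x : ℕ) : ℝ :=
  ∑ q ∈ (pairs θ x).filter (fun q : ℕ × ℕ => ((q.1 * q.2 : ℕ) : ℝ) ≤ (x : ℝ) ^ (2 - μ)),
    (jacobiSym (q.1 : ℤ) q.2 : ℝ) * disc (q.1 * q.2) x

def Dtail (θ μ : ℝ) (x : ℕ) : ℝ :=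
  ∑ q ∈ (pairs θ x).filter (fun q : ℕ × ℕ => ¬ ((q.1 * q.2 : ℕ) : ℝ) ≤ (x : ℝ) ^ (2 - μ)),
    (jacobiSym (q.1 : ℤ) q.2 : ℝ) * disc (q.1 * q.2) x

def rootWeylSum (h : ℤ) (q : ℕ) : ℂ :=
  ∑ ν ∈ (Finset.range q).filter (fun ν : ℕ => q ∣ ν ^ 2 + 1),
    Complex.exp (2 * Real.pi * Complex.I * (h : ℂ) * (ν : ℂ) / (q : ℂ))

def twistedSum (h : ℤ) (P₁ P₁' P₂ P₂' : ℕ) : ℂ :=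
  ∑ Q ∈ (Finset.Ioc P₁ P₁').filter (fun Q : ℕ => Q.Prime ∧ Q % 4 = 1),
    ∑ Q' ∈ (Finset.Ioc P₂ P₂').filter (fun Q' : ℕ => Q'.Prime ∧ Q' % 4 = 1),
      (jacobiSym (Q : ℤ) Q' : ℂ) * rootWeylSum h (Q * Q')

def TierWeylBound (θ μ : ℝ) : Prop :=
  ∃ ε₀ : ℝ, 0 < ε₀ ∧ ∃ x₀ : ℕ, ∀ x : ℕ, x₀ ≤ x → ∀ P₁ P₁' P₂ P₂' : ℕ,
    (x : ℝ) ^ θ ≤ 2 * (P₁ : ℝ) → P₁ ≤ P₁' → P₁' ≤ 2 * P₁ → P₁ ≤ P₂ → P₂ ≤ P₂' → P₂' ≤ 2 * P₂ →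
      ((P₁ * P₂ : ℕ) : ℝ) ≤ (x : ℝ) ^ (2 - μ) →
        ∀ h : ℤ, h ≠ 0 → (|h| : ℝ) ≤ ((P₁ * P₂ : ℕ) : ℝ) * (x : ℝ) ^ (ε₀ - 1) →
          ‖twistedSum h P₁ P₁' P₂ P₂'‖ ≤ (x : ℝ) ^ (1 - ε₀)

def PairForm : Prop :=
  ∀ θ : ℝ, 1 / 2 < θ → θ < 1 → ∀ x : ℕ, 4 ≤ x →
    J θ x = ∑ q ∈ pairs θ x, (jacobiSym (q.1 : ℤ) q.2 : ℝ) * (rootCount (q.1 * q.2) x : ℝ)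

def ExpectedPartCancels : Prop :=
  ∀ θ : ℝ, 1 / 2 < θ → θ < 1 → ∀ ε : ℝ, 0 < ε → ∀ᶠ x : ℕ in atTop, |Epart θ x| ≤ ε * x

def SmallCofactorTail : Prop :=
  ∀ θ : ℝ, 1 / 2 < θ → θ < 1 → ∀ ε : ℝ, 0 < ε → ∃ μ : ℝ, 0 < μ ∧ μ < 1 ∧
    ∀ᶠ x : ℕ in atTop, |Dtail θ μ x| ≤ ε * x

def PoissonReduction : Prop :=
  ∀ θ μ : ℝ, 1 / 2 < θ → θ < 1 → 0 < μ → μ < 1 → TierWeylBound θ μ →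
    ∀ ε : ℝ, 0 < ε → ∀ᶠ x : ℕ in atTop, |Dbulk θ μ x| ≤ ε * x

def WeylShallow : Prop :=
  ∀ θ μ : ℝ, 1 / 2 < θ → θ < 1 → 2 / 3 ≤ μ → μ < 1 → TierWeylBound θ μ

def WeylDeep : Prop :=
  ∀ θ μ : ℝ, 1 / 2 < θ → θ < 1 → 0 < μ → μ < 2 / 3 → TierWeylBound θ μ

/-! ### Finding 1: `TierWeylBound` is antitone in the tier parameter; STUB 5 is implied by STUB 6 -/

/-- A smaller tier parameter `μ` means MORE admissible boxes (`P₁P₂ ≤ x^{2-μ}` is weaker), the same `ε₀`,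
the same frequency range and the same bound: so `TierWeylBound θ μ → TierWeylBound θ μ'` whenever `μ ≤ μ'`. -/
theorem tierWeylBound_antitone {θ μ μ' : ℝ} (hμ : μ ≤ μ') (h : TierWeylBound θ μ) :
    TierWeylBound θ μ' := by
  obtain ⟨ε₀, hε₀, x₀, H⟩ := h
  refine ⟨ε₀, hε₀, max x₀ 1, fun x hx P₁ P₁' P₂ P₂' h1 h2 h3 h4 h5 h6 h7 hh hh0 hhb => ?_⟩
  have hx₀ : x₀ ≤ x := le_trans (le_max_left _ _) hx
  have hx1 : (1 : ℝ) ≤ x := by exact_mod_cast le_trans (le_max_right _ _) hx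
  have hmono : (x : ℝ) ^ (2 - μ') ≤ (x : ℝ) ^ (2 - μ) :=
    Real.rpow_le_rpow_of_exponent_le hx1 (by linarith)
  exact H x hx₀ P₁ P₁' P₂ P₂' h1 h2 h3 h4 h5 h6 (h7.trans hmono) hh hh0 hhb

/-- **STUB 5 is redundant:** `WeylDeep → WeylShallow` (apply STUB 6 at `μ = 1/2` and lift by antitonicity). -/
theorem weylShallow_of_weylDeep (h₆ : WeylDeep) : WeylShallow := by
  intro θ μ hθ₁ hθ₂ hμ _
  have h12 : TierWeylBound θ (1 / 2) := h₆ θ (1 / 2) hθ₁ hθ₂ (by norm_num) (by norm_num)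
  exact tierWeylBound_antitone (by linarith) h12

/-- **The crux from FIVE stubs** (1, 2, 3, 4, 6 — no `stub_weylShallow`): identical `ε/3` bookkeeping to the
skeleton's `SplitBlockJacobi_of`, the case split `2/3 ≤ μ` replaced by STUB 6 at `min μ (1/2)` + antitonicity. -/
theorem SplitBlockJacobi_of_five (h₁ : PairForm) (h₂ : ExpectedPartCancels) (h₃ : SmallCofactorTail)
    (h₄ : PoissonReduction) (h₆ : WeylDeep) :
    Summit.Parity.BatemanHorn.Theses.IsogenyRedei.SplitBlockJacobi := by
  intro θ hθ₁ hθ₂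
  rw [Asymptotics.isLittleO_iff]
  intro c hc
  have hc3 : 0 < c / 3 := by positivity
  obtain ⟨μ, hμ0, hμ1, hT⟩ := h₃ θ hθ₁ hθ₂ (c / 3) hc3
  have hW : TierWeylBound θ μ := by
    have hmin : TierWeylBound θ (min μ (1 / 2)) :=
      h₆ θ (min μ (1 / 2)) hθ₁ hθ₂ (lt_min hμ0 (by norm_num))
        (lt_of_le_of_lt (min_le_right _ _) (by norm_num))
    exact tierWeylBound_antitone (min_le_left _ _) hmin
  have hB : ∀ᶠ x : ℕ in atTop, |Dbulk θ μ x| ≤ c / 3 * x := h₄ θ μ hθ₁ hθ₂ hμ0 hμ1 hW (c / 3) hc3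
  have hE : ∀ᶠ x : ℕ in atTop, |Epart θ x| ≤ c / 3 * x := h₂ θ hθ₁ hθ₂ (c / 3) hc3
  filter_upwards [hT, hB, hE, eventually_ge_atTop 4] with x hxT hxB hxE hx4
  have hsplit : J θ x = Epart θ x + (Dbulk θ μ x + Dtail θ μ x) := by
    rw [h₁ θ hθ₁ hθ₂ x hx4]
    have hpt : ∀ q ∈ pairs θ x,
        (jacobiSym (q.1 : ℤ) q.2 : ℝ) * (rootCount (q.1 * q.2) x : ℝ) =
          (jacobiSym (q.1 : ℤ) q.2 : ℝ) * (4 * (x : ℝ) / ((q.1 * q.2 : ℕ) : ℝ)) +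
            (jacobiSym (q.1 : ℤ) q.2 : ℝ) * disc (q.1 * q.2) x := by
      intro q _
      unfold disc
      ring
    rw [Finset.sum_congr rfl hpt, Finset.sum_add_distrib]
    unfold Epart Dbulk Dtail
    congr 1
    exact (Finset.sum_filter_add_sum_filter_not _ _ _).symm
  show ‖J θ x‖ ≤ c * ‖(x : ℝ)‖
  rw [hsplit, Real.norm_eq_abs, Real.norm_eq_abs, Nat.abs_cast]
  have hA1 := abs_add_le (Epart θ x) (Dbulk θ μ x + Dtail θ μ x)
  have hA2 := abs_add_le (Dbulk θ μ x) (Dtail θ μ x)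
  linarith

/-! ### Finding 2: the single-row instances (over-strength map) -/

/-- A sub-interval `(Q₀ - 1, Q₀]` of the `Q`-range contains only `Q₀`; if `Q₀` is a prime `≡ 1 (mod 4)` the
twisted sum collapses to ONE ROW: a linear sum over the primes `Q' ∈ (P₂, P₂']`. -/
theorem twistedSum_row (h : ℤ) {Q₀ : ℕ} (hQ₀ : Q₀.Prime) (hQ₀4 : Q₀ % 4 = 1) (P₂ P₂' : ℕ) :
    twistedSum h (Q₀ - 1) Q₀ P₂ P₂' =
      ∑ Q' ∈ (Finset.Ioc P₂ P₂').filter (fun Q' : ℕ => Q'.Prime ∧ Q' % 4 = 1),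
        (jacobiSym (Q₀ : ℤ) Q' : ℂ) * rootWeylSum h (Q₀ * Q') := by
  unfold twistedSum
  have h1 : 1 ≤ Q₀ := hQ₀.one_lt.le
  have hIoc : Finset.Ioc (Q₀ - 1) Q₀ = {Q₀} := by
    ext n
    simp only [Finset.mem_Ioc, Finset.mem_singleton]
    omega
  rw [hIoc, Finset.filter_singleton, if_pos ⟨hQ₀, hQ₀4⟩, Finset.sum_singleton]

/-- **Single rows inside `TierWeylBound θ μ`.** For every prime `Q₀ ≡ 1 (4)` with `x^θ ≤ 2(Q₀-1)` and every
column range `(P₂, P₂'] ⊂ (P₂, 2P₂]` with `Q₀ - 1 ≤ P₂`, `(Q₀-1)P₂ ≤ x^{2-μ}`, and every frequency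
`0 < |h| ≤ (Q₀-1)P₂·x^{ε₀-1}`, the ROW sum is bounded by `x^{1-ε₀}`. When `μ + θ < 1` the row length `P₂` may be
`≍ x^{2-μ-θ} ≫ x^{1-ε₀}`: then this is a power saving in a Legendre-twisted DFI prime sum (e.g. at `h = Q₀` the
row is `4 Σ_{p} (Q₀|p) cos(2π ν_p/p)`, `ν_p² ≡ -1 (p)`), for which only savings `(log x)^{-1}` are in print. -/
theorem row_of_tierWeylBound {θ μ : ℝ} (hT : TierWeylBound θ μ) :
    ∃ ε₀ : ℝ, 0 < ε₀ ∧ ∃ x₀ : ℕ, ∀ x : ℕ, x₀ ≤ x → ∀ Q₀ : ℕ, Q₀.Prime → Q₀ % 4 = 1 →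
      (x : ℝ) ^ θ ≤ 2 * ((Q₀ - 1 : ℕ) : ℝ) → ∀ P₂ P₂' : ℕ, Q₀ - 1 ≤ P₂ → P₂ ≤ P₂' → P₂' ≤ 2 * P₂ →
        (((Q₀ - 1) * P₂ : ℕ) : ℝ) ≤ (x : ℝ) ^ (2 - μ) →
          ∀ h : ℤ, h ≠ 0 → (|h| : ℝ) ≤ (((Q₀ - 1) * P₂ : ℕ) : ℝ) * (x : ℝ) ^ (ε₀ - 1) →
            ‖∑ Q' ∈ (Finset.Ioc P₂ P₂').filter (fun Q' : ℕ => Q'.Prime ∧ Q' % 4 = 1),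
                (jacobiSym (Q₀ : ℤ) Q' : ℂ) * rootWeylSum h (Q₀ * Q')‖ ≤ (x : ℝ) ^ (1 - ε₀) := by
  obtain ⟨ε₀, hε₀, x₀, H⟩ := hT
  refine ⟨ε₀, hε₀, x₀, fun x hx Q₀ hQ₀ hQ₀4 hθ P₂ P₂' h4 h5 h6 h7 h hh hhb => ?_⟩
  have h2 : 2 ≤ Q₀ := hQ₀.two_le
  have h3 : Q₀ ≤ 2 * (Q₀ - 1) := by omega
  have := H x hx (Q₀ - 1) Q₀ P₂ P₂' hθ (Nat.sub_le Q₀ 1) h3 h4 h5 h6 h7 h hh hhb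
  rwa [twistedSum_row h hQ₀ hQ₀4] at this

/-- The lead's corner hypothesis (hypothesis of the registered helper `tierWeylBound_of_mixedBilinear`,
verbatim but for the local names `twistedSum`): note the ABSENCE of any bound on `P₂` in terms of `P₁`. -/
def MixedBilinear (δ₀ : ℝ) : Prop :=
  ∃ P₀ : ℕ, ∀ P₁ P₁' P₂ P₂' : ℕ, P₀ ≤ P₁ → P₁ ≤ P₁' → P₁' ≤ 2 * P₁ → P₁ ≤ P₂ → P₂ ≤ P₂' →
    P₂' ≤ 2 * P₂ → ∀ h : ℤ, h ≠ 0 → (|h| : ℝ) ≤ ((P₁ * P₂ : ℕ) : ℝ) ^ δ₀ →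
      ‖twistedSum h P₁ P₁' P₂ P₂'‖ ≤ ((P₁ * P₂ : ℕ) : ℝ) ^ (1 - δ₀)

/-- **Single rows inside `MixedBilinear δ₀`:** for every FIXED prime `Q₀ ≡ 1 (4)`, `Q₀ > P₀`, and `P₂ → ∞`:
`‖Σ_{p ∈ (P₂,P₂']} (Q₀|p) S(h, Q₀ p)‖ ≤ ((Q₀-1)P₂)^{1-δ₀}` for all `0 < |h| ≤ ((Q₀-1)P₂)^{δ₀}` — a power saving
`P₂^{δ₀}` (up to the constant `Q₀`) in the twisted Duke–Friedlander–Iwaniec prime sum, uniformly in a polynomial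
range of `h`. This is what makes the hypothesis, as typed, contain an open problem the corner never needs. -/
theorem row_of_mixedBilinear {δ₀ : ℝ} (hM : MixedBilinear δ₀) :
    ∃ P₀ : ℕ, ∀ Q₀ : ℕ, Q₀.Prime → Q₀ % 4 = 1 → P₀ + 1 ≤ Q₀ → ∀ P₂ P₂' : ℕ, Q₀ - 1 ≤ P₂ → P₂ ≤ P₂' →
      P₂' ≤ 2 * P₂ → ∀ h : ℤ, h ≠ 0 → (|h| : ℝ) ≤ (((Q₀ - 1) * P₂ : ℕ) : ℝ) ^ δ₀ →
        ‖∑ Q' ∈ (Finset.Ioc P₂ P₂').filter (fun Q' : ℕ => Q'.Prime ∧ Q' % 4 = 1),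
            (jacobiSym (Q₀ : ℤ) Q' : ℂ) * rootWeylSum h (Q₀ * Q')‖ ≤ (((Q₀ - 1) * P₂ : ℕ) : ℝ) ^ (1 - δ₀) := by
  obtain ⟨P₀, H⟩ := hM
  refine ⟨P₀, fun Q₀ hQ₀ hQ₀4 hP P₂ P₂' h4 h5 h6 h hh hhb => ?_⟩
  have h2 : 2 ≤ Q₀ := hQ₀.two_le
  have hP' : P₀ ≤ Q₀ - 1 := by omega
  have h3 : Q₀ ≤ 2 * (Q₀ - 1) := by omega
  have := H (Q₀ - 1) Q₀ P₂ P₂' hP' (Nat.sub_le Q₀ 1) h3 h4 h5 h6 h hh hhb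
  rwa [twistedSum_row h hQ₀ hQ₀4] at this

/-- The REPAIRED corner hypothesis (aspect ratio bounded): all the corner application
`MixedBilinear δ₀ → TierWeylBound θ μ (μ ≥ 1 - δ₀/3)` ever uses, since there `x^θ ≤ 2P₁`, `θ > 1/2` and
`P₁P₂ ≤ x^{1+δ₀/3}` force `P₂ ≤ 4^{1+δ₀/3} P₁^{1+2δ₀/3}`; with `P₂ ≤ 8 P₁^{1+δ₀}` every single row is bounded
TRIVIALLY (`4·#{Q'} ≤ 8P₂ ≤ 64 P₁^{1+δ₀} ≤ (P₁P₂)^{1-δ₀}` as soon as `δ₀ ≤ 1/4`, `P₁` large), so the repaired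
statement is genuinely bilinear. -/
def MixedBilinearBalanced (δ₀ : ℝ) : Prop :=
  ∃ P₀ : ℕ, ∀ P₁ P₁' P₂ P₂' : ℕ, P₀ ≤ P₁ → P₁ ≤ P₁' → P₁' ≤ 2 * P₁ → P₁ ≤ P₂ → P₂ ≤ P₂' →
    P₂' ≤ 2 * P₂ → (P₂ : ℝ) ≤ 8 * (P₁ : ℝ) ^ (1 + δ₀) → ∀ h : ℤ, h ≠ 0 → (|h| : ℝ) ≤ ((P₁ * P₂ : ℕ) : ℝ) ^ δ₀ →
      ‖twistedSum h P₁ P₁' P₂ P₂'‖ ≤ ((P₁ * P₂ : ℕ) : ℝ) ^ (1 - δ₀)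

theorem mixedBilinearBalanced_of_mixedBilinear {δ₀ : ℝ} (h : MixedBilinear δ₀) : MixedBilinearBalanced δ₀ := by
  obtain ⟨P₀, H⟩ := h
  exact ⟨P₀, fun P₁ P₁' P₂ P₂' h0 h1 h2 h3 h4 h5 _ hh hh0 hhb => H P₁ P₁' P₂ P₂' h0 h1 h2 h3 h4 h5 hh hh0 hhb⟩

/-! ### Scratch sanity checks -/

example : rootCount 5 4 = 2 := by decide
example : jacobiSym 5 13 = -1 := by norm_num
/-- `(13|101) = +1`? `101 ≡ 10 (mod 13)`, `10 ≡ 6² = 36 ≡ 10` ✓: the row `Q₀ = 13` of the resonance table has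
both signs among its columns. -/
example : jacobiSym 13 101 = 1 := by norm_num

end Summit.Parity.BatemanHorn.Cruxes.SplitBlockJacobi.DrefuteG2

end
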